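import Mathlib

/-!
# Peeling frame, K–L witness lemma: a «monomial · unit-witness» chart certificate gives principal augmentation ideals at every prime

(crux stmt-ResolutionOfSingularities-15640 `WildQuotients.WildQuotientResolution`, post-V5 card O of
res-L1-w45c-idea-2 (specimens O8 `𝔸⁴/(ℤ/4)` and O9 `(V₂⊗V₂)/(C₂×C₂)`, char 2), design memos
`L/w45c/O8-Z4-DESIGN.md` §3/§5 (stub-1) and `L/w45c/O9-KLEINFOUR-DESIGN.md` §3 (stub-3); SHARED-FRAME
piece PF-A of res-L1-w45c-plan-1's ORDER 2026-08-27T16:00:38Z. [OURS · L1 W4.5c] — generic commutative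
algebra, NOT a statement of any manuscript; replaces the role of no printed item. Mathlib only.)

The second Király–Lütkebohmert step of a peeled wild quotient runs on an explicit regular ring `S` (the
invariants of the first involution on a Rees chart) with an explicit automorphism `τ`; the tree's K–L
theorem (`TameTransfer.isRegularRing_fixedPoints_zpowers`, used through stub-3's
`BlowupExit.isRegular_pieceQuot_of_KL_twice`) asks that the augmentation ideal
`I_τ = (τ u − u : u ∈ S)` become principal in `S_𝔮` at the relevant primes `𝔮`. The chart engines
(idea-2's `tau_game`, tri-1's `freeze`, stub-1's `z4_tau_charts`) deliver exactly the following data: an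
«exceptional monomial» `ε` dividing every increment, residuals `r_i` with `ε r_i ∈ I_τ`, and a SMALL
witness `s ∈ (r_i)` that avoids every prime containing `I_τ`. This file turns such data into the K–L
hypothesis, for an ARBITRARY self-map `f` of a commutative ring (no homomorphism property is used):

* `isPrincipal_map_atPrime_of_witness` — at every prime `𝔮`, `I_f · S_𝔮` is principal (it is `(ε)`
  if `I_f ≤ 𝔮` and `(1)` otherwise);
* `forall_sub_mem_of_adjoin_eq_top` — to check `τ b − b ∈ J` for all `b` it suffices to check the
  generators of `S` as a `k`-algebra (`{b | τ b − b ∈ J}` is a subalgebra when `τ` is a `k`-algebra map);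
* `inv_sub_mem_of_sub_mem` — and inverses of units come for free (`τ u⁻¹ − u⁻¹ = −(τ u)⁻¹ u⁻¹ (τ u − u)`),
  which covers localised chart rings `k[u₁,…,u_n][1/h]`;
* `mul_mem_span_range_sub_of_forall` — bookkeeping: `ε s ∈ I_f` from `ε r_i ∈ I_f` and `s ∈ (r_i)`.
-/

-- single-problem summit: the doubled namespace component `ResolutionOfSingularities` is forced
set_option linter.dupNamespace false

namespace Summit.ResolutionOfSingularities.ResolutionOfSingularities.Theorems.WildQuotientResolution.PeelingFrame

variable {S : Type*} [CommRing S]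

/-- Bookkeeping: if `ε · r i` lies in an ideal `I` for every `i`, then `ε · s ∈ I` for every `s` in the
ideal generated by the `r i`. [folklore] -/
theorem mul_mem_of_mem_span_range {ι : Type*} (I : Ideal S) (ε : S) (r : ι → S)
    (hr : ∀ i, ε * r i ∈ I) {s : S} (hs : s ∈ Ideal.span (Set.range r)) : ε * s ∈ I := by
  refine Submodule.span_induction (p := fun x _ => ε * x ∈ I) ?_ ?_ ?_ ?_ hs
  · rintro _ ⟨i, rfl⟩
    exact hr i
  · rw [mul_zero]
    exact I.zero_mem
  · intro x y _ _ hx hy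
    rw [mul_add]
    exact I.add_mem hx hy
  · intro a x _ hx
    rw [smul_eq_mul, mul_left_comm]
    exact I.mul_mem_left a hx

/-- **The K–L witness lemma.** Let `f : S → S` be any self-map of a commutative ring, and
`I = (f u − u : u ∈ S)` its «augmentation ideal». Suppose every increment is divisible by `ε`
(`I ≤ (ε)`), that `ε · r i ∈ I` for a family of «residuals» `r i`, and that some `s ∈ (r i : i)` lies in no
prime ideal containing `I`. Then for EVERY prime `𝔮` of `S` the extension of `I` to `S_𝔮` is principal:
if `I ≤ 𝔮` then `s` is a unit of `S_𝔮`, so `ε = (ε s) s⁻¹ ∈ I S_𝔮` and `I S_𝔮 = (ε)`; otherwise some element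
of `I` is a unit of `S_𝔮` and `I S_𝔮 = (1)`. (This is the `hdiv` hypothesis of
`BlowupExit.isRegular_pieceQuot_of_KL_twice` / `TameTransfer.isRegularRing_fixedPoints_zpowers`, with the
fixedness of `𝔮` not even used.) [folklore] -/
theorem isPrincipal_map_atPrime_of_witness (f : S → S) (ε : S)
    (hε : Ideal.span (Set.range fun u : S => f u - u) ≤ Ideal.span {ε})
    {ι : Type*} (r : ι → S) (hr : ∀ i, ε * r i ∈ Ideal.span (Set.range fun u : S => f u - u))
    (s : S) (hs : s ∈ Ideal.span (Set.range r))
    (hsq : ∀ (𝔮 : Ideal S) [𝔮.IsPrime], Ideal.span (Set.range fun u : S => f u - u) ≤ 𝔮 → s ∉ 𝔮)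
    (𝔮 : Ideal S) [𝔮.IsPrime] :
    ((Ideal.span (Set.range fun u : S => f u - u)).map
      (algebraMap S (Localization.AtPrime 𝔮))).IsPrincipal := by
  set I : Ideal S := Ideal.span (Set.range fun u : S => f u - u) with hI
  by_cases hIq : I ≤ 𝔮
  · -- `s` is a unit at `𝔮`, and `I S_𝔮 = (ε)`
    have hsu : IsUnit (algebraMap S (Localization.AtPrime 𝔮) s) :=
      IsLocalization.map_units (Localization.AtPrime 𝔮) (⟨s, hsq 𝔮 hIq⟩ : 𝔮.primeCompl)
    have hεs : ε * s ∈ I := mul_mem_of_mem_span_range I ε r hr hs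
    have heq : I.map (algebraMap S (Localization.AtPrime 𝔮)) =
        Ideal.span {algebraMap S (Localization.AtPrime 𝔮) ε} := by
      apply le_antisymm
      · rw [Ideal.map_le_iff_le_comap]
        intro x hx
        rw [Ideal.mem_comap]
        obtain ⟨c, hc⟩ := Ideal.mem_span_singleton'.mp (hε hx)
        rw [← hc, map_mul]
        exact Ideal.mul_mem_left _ _ (Ideal.mem_span_singleton_self _)
      · rw [Ideal.span_singleton_le_iff_mem]
        obtain ⟨v, hv⟩ := hsu
        have hmem : algebraMap S (Localization.AtPrime 𝔮) (ε * s) ∈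
            I.map (algebraMap S (Localization.AtPrime 𝔮)) := Ideal.mem_map_of_mem _ hεs
        rw [map_mul, ← hv] at hmem
        have h2 := Ideal.mul_mem_right (↑v⁻¹ : Localization.AtPrime 𝔮) _ hmem
        rwa [mul_assoc, Units.mul_inv, mul_one] at h2
    rw [heq]
    exact ⟨⟨algebraMap S (Localization.AtPrime 𝔮) ε, by rw [Ideal.submodule_span_eq]⟩⟩
  · -- some element of `I` is a unit at `𝔮`: `I S_𝔮 = ⊤`
    obtain ⟨a, haI, haq⟩ := Set.not_subset.mp hIq
    have hau : IsUnit (algebraMap S (Localization.AtPrime 𝔮) a) :=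
      IsLocalization.map_units (Localization.AtPrime 𝔮) (⟨a, haq⟩ : 𝔮.primeCompl)
    have htop : I.map (algebraMap S (Localization.AtPrime 𝔮)) = ⊤ :=
      Ideal.eq_top_of_isUnit_mem _ (Ideal.mem_map_of_mem _ haI) hau
    rw [htop]
    exact ⟨⟨1, by rw [Ideal.submodule_span_eq, Ideal.span_singleton_one]⟩⟩

/-- Pointwise form of `I ≤ (ε)`: it suffices that every increment `f u − u` is a multiple of `ε`.
[folklore] -/
theorem span_range_sub_le_span_singleton (f : S → S) (ε : S)
    (h : ∀ u : S, f u - u ∈ Ideal.span {ε}) :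
    Ideal.span (Set.range fun u : S => f u - u) ≤ Ideal.span {ε} := by
  rw [Ideal.span_le]
  rintro _ ⟨u, rfl⟩
  exact h u

/-- **Increments of generators suffice.** For a `k`-algebra map `τ : S → S` and an ideal `J`, the set
`{b | τ b − b ∈ J}` is a `k`-subalgebra (`τ(ab) − ab = τ a · (τ b − b) + (τ a − a) · b`); hence if
`τ g − g ∈ J` for all `g` in a set `G` generating `S` as a `k`-algebra, then `τ b − b ∈ J` for every `b`.
[folklore] -/
theorem forall_sub_mem_of_adjoin_eq_top {k : Type*} [CommSemiring k] [Algebra k S]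
    (τ : S →ₐ[k] S) (J : Ideal S) {G : Set S} (hG : Algebra.adjoin k G = ⊤)
    (hgen : ∀ g ∈ G, τ g - g ∈ J) (b : S) : τ b - b ∈ J := by
  have hb : b ∈ Algebra.adjoin k G := by
    rw [hG]
    exact Algebra.mem_top
  refine Algebra.adjoin_induction (p := fun x _ => τ x - x ∈ J) ?_ ?_ ?_ ?_ hb
  · exact hgen
  · intro c
    rw [AlgHom.commutes, sub_self]
    exact J.zero_mem
  · intro x y _ _ hx hy
    have h : τ (x + y) - (x + y) = (τ x - x) + (τ y - y) := by
      rw [map_add]; ring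
    rw [h]
    exact J.add_mem hx hy
  · intro x y _ _ hx hy
    have h : τ (x * y) - x * y = τ x * (τ y - y) + (τ x - x) * y := by
      rw [map_mul]; ring
    rw [h]
    exact J.add_mem (J.mul_mem_left _ hy) (J.mul_mem_right _ hx)

/-- **Inverses of units come for free.** For a ring homomorphism `τ : S → S`, an ideal `J` and a unit
`u` with `τ u − u ∈ J`: `τ u⁻¹ − u⁻¹ = −(τ u)⁻¹ · u⁻¹ · (τ u − u) ∈ J`. (So on a localised chart ring
`k[u₁,…,u_n][1/h]` the generators `u_j` and `h` suffice.) [folklore] -/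
theorem inv_sub_mem_of_sub_mem (τ : S →+* S) (J : Ideal S) (u : Sˣ)
    (hu : τ (u : S) - u ∈ J) : τ (↑u⁻¹ : S) - ↑u⁻¹ ∈ J := by
  -- `τ u` is a unit with inverse `τ u⁻¹`
  have hτu : τ (u : S) * τ (↑u⁻¹ : S) = 1 := by
    rw [← map_mul, Units.mul_inv, map_one]
  have key : τ (↑u⁻¹ : S) - ↑u⁻¹ = -(τ (↑u⁻¹ : S) * ↑u⁻¹) * (τ (u : S) - u) := by
    have h1 : τ (↑u⁻¹ : S) * ↑u⁻¹ * τ (u : S) = ↑u⁻¹ := by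
      calc τ (↑u⁻¹ : S) * ↑u⁻¹ * τ (u : S) = (τ (u : S) * τ (↑u⁻¹ : S)) * ↑u⁻¹ := by ring
        _ = ↑u⁻¹ := by rw [hτu, one_mul]
    have h2 : τ (↑u⁻¹ : S) * ↑u⁻¹ * (u : S) = τ (↑u⁻¹ : S) := by
      rw [mul_assoc, Units.inv_mul, mul_one]
    calc τ (↑u⁻¹ : S) - ↑u⁻¹ = τ (↑u⁻¹ : S) * ↑u⁻¹ * (u : S) - τ (↑u⁻¹ : S) * ↑u⁻¹ * τ (u : S) := by
          rw [h1, h2]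
      _ = -(τ (↑u⁻¹ : S) * ↑u⁻¹) * (τ (u : S) - u) := by ring
  rw [key]
  exact J.mul_mem_left _ hu

/-- Localised-chart form of `forall_sub_mem_of_adjoin_eq_top`: if `S` is generated as a `k`-algebra by a
set `G` together with the inverse of a unit `h`, and `τ g − g ∈ J` for `g ∈ G` and for `g = h`, then
`τ b − b ∈ J` for all `b`. [folklore] -/
theorem forall_sub_mem_of_adjoin_insert_inv_eq_top {k : Type*} [CommSemiring k] [Algebra k S]
    (τ : S →ₐ[k] S) (J : Ideal S) {G : Set S} (h : Sˣ)
    (hG : Algebra.adjoin k (insert (↑h⁻¹ : S) G) = ⊤)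
    (hgen : ∀ g ∈ G, τ g - g ∈ J) (hh : τ (h : S) - h ∈ J) (b : S) : τ b - b ∈ J := by
  refine forall_sub_mem_of_adjoin_eq_top τ J hG ?_ b
  intro g hg
  rcases Set.mem_insert_iff.mp hg with rfl | hg
  · exact inv_sub_mem_of_sub_mem (τ : S →+* S) J h hh
  · exact hgen g hg

end Summit.ResolutionOfSingularities.ResolutionOfSingularities.Theorems.WildQuotientResolution.PeelingFrame
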